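import Summits.HodgeConjecture.HodgeConjecture.Theorems.CyclicUnitaryPowersNodalMeridianExists
import Summits.HodgeConjecture.HodgeConjecture.Theorems.CyclicUnitaryPowersPLPackageOfMeridians
import Literature.AlgebraicGeometry.HodgeTheory.CyclicCoverNodalMeridianLocalMonodromyBound
import Literature.AlgebraicGeometry.HodgeTheory.LocalMonodromyDatumConjugate
import HarnessLib

/-!
# K1-A helper: the nodal-meridian local-monodromy fact F1‡ follows from its instance for ONE explicit circle
# (route `CyclicUnitaryPowers`, item stmt-HodgeConjecture-19544; programme "localisation", step A0)

Prover seat `hodge-nonav-prover-Ax` (g10), cell `hodge-nonav`. Helper file `--supports stmt-HodgeConjecture-19544`; sorry-free; no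
definition, no new named fact. CONDITIONAL result (a reduction); nothing here says HC ∕ HC_AV is proved; rung F-H1 not moved.

`Literature.AlgebraicGeometry.HodgeTheory.carlsonToledo1999_nodalMeridianLocalMonodromyBound` (F1‡, the only Picard–Lefschetz
input of K1-A) quantifies over EVERY meridian `μ` of the discriminant `V(D)` centred at a one-nodal branch curve, every base point
and every reading `γ` of `μ.loop` in `S(ℂ)`. This file reduces it to the geometric statement for ONE explicit pencil: the
meridians with centre `a₁ = coeff(f₁)`, `f₁ = x₂^{p−2}x₀x₁ + x₀^p + x₁^p` (the tree's uninodal form), direction the coefficient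
`e_{x₂^p}` of `x₂^p`, and small radius `ε ≤ ε₀`:

* `eval_pderiv_single_ne_zero_of_uninodal` — at `a₁` the partial `∂D/∂a_{x₂^p}` is non-zero (F-DISC-1: `dD(a₁) = u·c·ev_{e₂}` and
  `ev_{e₂}(e_{x₂^p}) = 1`), so that direction is transversal;
* `exists_meridian_center_direction_small` — at every base point there is a meridian with centre `a₁`, direction `e_{x₂^p}` and
  radius `≤ ε₀` (`MeridianConj.exists_meridian` + shrinking the radius, new leash by path-connectedness);
* `isRatTransport_meridian_loop` — the transport along `μ.loop = leash · circle · leash⁻¹` read in `S(ℂ)` is `T_L ∘ T_c ∘ T_L⁻¹`;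
* **`nodalMeridianLocalMonodromyBound_of_circle`** — if for some `ε₀ > 0` every such small explicit circle has a transport carrying the
  datum `∃ V, (T−1)H ⊆ V ∧ Σ_{i<p} Tⁱ|_V = 0 ∧ dim V ≤ p − 1`, then the datum holds for the transport of EVERY meridian with
  EVERY centre (leash conjugation `exists_localMonodromyDatum_of_conj`; conjugacy of all meridians of the irreducible `V(D)`,
  `affineHypersurfaceComplement_meridian_isConj_holds`, through the monodromy homomorphism `exists_conj_of_isConj`;
  `exists_localMonodromyDatum_of_mul_conj`) — i.e. the `p`-instance of F1‡.

## References

* [CarlsonToledo1999] J. A. Carlson, D. Toledo, Duke Math. J. 97 (1999), §2, §3, §6 (kdoublept) (held text p0013–p0014).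
* [Shimada2010ZvK] I. Shimada, arXiv:0906.1074, §3 Prop. 3.4.
* [VoisinHodgeII2003] C. Voisin, Hodge Theory and Complex Algebraic Geometry II, §2.1.1 Lemma 2.7, Cor. 2.8, §3.1.2.
-/

set_option linter.dupNamespace false

noncomputable section

open MvPolynomial _root_.Topology _root_.Filter CategoryTheory
open Literature.AlgebraicTopology.SingularHomology
open Literature.AlgebraicGeometry.Motives Literature.AlgebraicGeometry.Motives.UniversalHypersurface
open Literature.AlgebraicGeometry.HodgeTheory Literature.AlgebraicGeometry.HodgeTheory.DiscriminantBranches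
open Literature.AlgebraicGeometry.FundamentalGroup
open Literature.NumberTheory.Transcendental (hasFDerivAt_eval)
open Summit.HodgeConjecture.HodgeConjecture.Theorems.CyclicUnitaryPowersUninodalTernaryForm
open Summit.HodgeConjecture.HodgeConjecture.Theorems.CyclicUnitaryPowersNodalMeridianExists
open Summit.HodgeConjecture.HodgeConjecture.Theorems.SignSymmetricPowersMeridianMonodromy
open Summit.HodgeConjecture.HodgeConjecture.Theorems.CyclicUnitaryPowersPLPackageOfMeridians

namespace Summit.HodgeConjecture.HodgeConjecture.Theorems.CyclicUnitaryPowersNodalMeridianOfCircle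

/-! ### §1 The transversal direction `e_{x₂^p}` at the explicit one-nodal form -/

/-- The index of the monomial `x₂^p` among ternary forms of degree `p`. [cite: CarlsonToledo1999, §2 (held text p0004)] -/
theorem degree_single_two (p : ℕ) : (Finsupp.single (2 : Fin 3) p).degree = p :=
  Finsupp.degree_single _ _

/-- `ev_x(e_m) = x^m`: the evaluation functional at `x` on the coefficient direction of the monomial `m`.
[cite: VoisinHodgeII2003, §2.1.1 Cor. 2.8] -/
theorem evalCoeffCLM_single {n d : ℕ} (x : Fin (n + 2) → ℂ) (m : DegIndex n d) :
    evalCoeffCLM n d x (Pi.single m 1) = m.1.prod fun j e => x j ^ e := by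
  classical
  rw [evalCoeffCLM_apply, formOfCoeffs_def]
  rw [Finset.sum_eq_single m]
  · simp [eval_monomial]
  · intro b _ hb
    simp [hb]
  · intro h; exact absurd (Finset.mem_univ m) h

/-- **At a one-nodal form with node `x`, the partial `∂D/∂a_m` is non-zero as soon as `x^m ≠ 0`** (F-DISC-1:
`D = u·φ` near `a₁`, `dφ(a₁) = c·ev_x`, so `∂_m D(a₁) = u(a₁) c x^m`). [cite: VoisinHodgeII2003, §2.1.1 Lemma 2.7 and Cor. 2.8] -/
theorem eval_pderiv_ne_zero_of_uninodal_of_prod_ne_zero {n d : ℕ} {Disc : MvPolynomial (DegIndex n d) ℂ}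
    (hirr : Irreducible Disc) (hV : ∀ a : DegIndex n d → ℂ, a ∈ singularCoeffs n d ↔ eval a Disc = 0)
    {f₁ : MvPolynomial (Fin (n + 2)) ℂ} (hf₁ : f₁.IsHomogeneous d) {x : Fin (n + 2) → ℂ}
    (hnod : IsNodalFormWithNodes f₁ ![x]) (m : DegIndex n d) (hm : (m.1.prod fun j e => x j ^ e) ≠ 0) :
    eval (coeffsOf n d f₁) (pderiv m Disc) ≠ 0 := by
  classical
  obtain ⟨W, hWo, haW, φ, u, c, hφ, hu, hu0, hDW⟩ :=
    discriminant_localBranches_nodal_holds n d 1 Disc hirr hV f₁ hf₁ ![x] hnod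
  obtain ⟨-, hφ0, hc0, hdφ⟩ := hφ 0
  set a₁ := coeffsOf n d f₁ with ha₁
  have hdu : HasFDerivAt u (fderiv ℂ u a₁) a₁ :=
    ((hu a₁ haW).differentiableAt (hWo.mem_nhds haW)).hasFDerivAt
  have hprod : HasFDerivAt (fun a => u a * φ 0 a)
      (u a₁ • (c 0 • evalCoeffCLM n d (![x] 0)) + φ 0 a₁ • fderiv ℂ u a₁) a₁ := hdu.mul hdφ
  have hEq : (fun a => eval a Disc) =ᶠ[𝓝 a₁] fun a => u a * φ 0 a := by
    filter_upwards [hWo.mem_nhds haW] with a ha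
    rw [hDW a ha, Fin.prod_univ_one]
  have hD : HasFDerivAt (fun a => eval a Disc)
      (u a₁ • (c 0 • evalCoeffCLM n d (![x] 0)) + φ 0 a₁ • fderiv ℂ u a₁) a₁ :=
    hprod.congr_of_eventuallyEq hEq
  have hL := (hasFDerivAt_eval Disc a₁).unique hD
  have hLw := congrArg (fun L : (DegIndex n d → ℂ) →L[ℂ] ℂ => L (Pi.single m 1)) hL
  simp only [_root_.sum_apply, _root_.smul_apply, ContinuousLinearMap.proj_apply, smul_eq_mul,
    _root_.add_apply, hφ0, zero_mul, add_zero, Matrix.cons_val_fin_one, evalCoeffCLM_single] at hLw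
  rw [Finset.sum_eq_single m (fun b _ hb => by simp [hb]) (fun h => absurd (Finset.mem_univ m) h)]
    at hLw
  simp only [Pi.single_eq_same, mul_one] at hLw
  rw [hLw]
  exact mul_ne_zero (hu0 a₁ haW) (mul_ne_zero hc0 hm)

/-! ### §2 The transport along a meridian loop is the leash-conjugate of the circle transport -/

section Meridians

variable {p : ℕ} [NeZero p]

omit [NeZero p] in
/-- `cyclicCoverLoopClass p γ` is the class of `γ` read in the universe subtype (`rfl`). [folklore] -/
theorem cyclicCoverLoopClass_eq {s : ComplexPoints (cyclicCoverBase p)} (γ : Path s s) :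
    cyclicCoverLoopClass p γ = Path.Homotopic.Quotient.mk
      (γ.map (continuous_id'.subtype_mk fun x : ComplexPoints (cyclicCoverBase p) => Set.mem_univ x)) := rfl

/-- **The transport along a meridian loop `leash · circle · leash⁻¹` read in `S(ℂ)`**: if `T_c` is a rational transport
along the circle, then for some rational transport `T_L` along the leash, `T_L.trans (T_c.trans T_L.symm)`
(`x ↦ T_L⁻¹(T_c(T_L x))`) is a rational transport along the class of the loop.
[cite: VoisinHodgeII2003, §3.1.2] [cite: Shimada2010ZvK, §3 Definition before Prop. 3.4] -/
theorem exists_isRatTransport_meridian_loop {D : MvPolynomial (TernaryIndex p) ℂ}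
    (χ : ComplexPoints (cyclicCoverBase p) ≃ₜ affineHypersurfaceComplement ![D])
    {b : affineHypersurfaceComplement ![D]} (μ : Meridian ![D] b 0)
    {Tc : bettiCohomology (fiberOver (cyclicCoverFamily p) (χ.symm μ.leashEnd)) 2 ≃ₗ[ℚ]
      bettiCohomology (fiberOver (cyclicCoverFamily p) (χ.symm μ.leashEnd)) 2}
    (hTc : IsRatTransport (cyclicCoverFamily p) 2 (cyclicCoverFamily_locallyTrivial p)
      (cyclicCoverLoopClass p (μ.circle.map χ.symm.continuous)) Tc) :
    ∃ TL : bettiCohomology (fiberOver (cyclicCoverFamily p) (χ.symm b)) 2 ≃ₗ[ℚ]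
        bettiCohomology (fiberOver (cyclicCoverFamily p) (χ.symm μ.leashEnd)) 2,
      IsRatTransport (cyclicCoverFamily p) 2 (cyclicCoverFamily_locallyTrivial p)
        (cyclicCoverLoopClass p (μ.loop.map χ.symm.continuous)) (TL.trans (Tc.trans TL.symm)) := by
  let L : Path (⟨χ.symm b, Set.mem_univ _⟩ : (Set.univ : Set (ComplexPoints (cyclicCoverBase p))))
      ⟨χ.symm μ.leashEnd, Set.mem_univ _⟩ :=
    (μ.leash.map χ.symm.continuous).map
      (continuous_id'.subtype_mk fun x : ComplexPoints (cyclicCoverBase p) => Set.mem_univ x)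
  obtain ⟨TL, hTL⟩ : ∃ TL : bettiCohomology (fiberOver (cyclicCoverFamily p) (χ.symm b)) 2 ≃ₗ[ℚ]
      bettiCohomology (fiberOver (cyclicCoverFamily p) (χ.symm μ.leashEnd)) 2,
      IsRatTransport (cyclicCoverFamily p) 2 (cyclicCoverFamily_locallyTrivial p) (Path.Homotopic.Quotient.mk L) TL :=
    exists_ratTransport (cyclicCoverFamily p) 2 (cyclicCoverFamily_locallyTrivial p)
      (isRationalClass_transportFun_cyclicCoverFamily) (Path.Homotopic.Quotient.mk L)
  refine ⟨TL, ?_⟩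
  have h := (hTL.trans _ _ _ hTc).trans _ _ _ hTL.symm
  have hpath : cyclicCoverLoopClass p (μ.loop.map χ.symm.continuous) =
      ((Path.Homotopic.Quotient.mk L).trans (cyclicCoverLoopClass p (μ.circle.map χ.symm.continuous))).trans
        (Path.Homotopic.Quotient.mk L).symm := by
    rw [cyclicCoverLoopClass_eq, cyclicCoverLoopClass_eq, ← Path.Homotopic.Quotient.mk_trans,
      ← Path.Homotopic.Quotient.mk_symm, ← Path.Homotopic.Quotient.mk_trans]
    congr 1
    simp only [L, Meridian.loop, Path.map_trans]
    rfl
  rw [hpath]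
  exact h

/-! ### §3 The explicit small meridian exists at every base point -/

omit [NeZero p] in
/-- **A meridian with prescribed centre, prescribed transversal direction and radius at most `ε₀`** at any base point
(`MeridianConj.exists_meridian` gives one of some radius; shrink the radius — the punctured disc only shrinks — and choose a new
leash by path-connectedness of the complement of the irreducible `V(D)`). [cite: Shimada2010ZvK, §3 (transversal discs)] -/
theorem exists_meridian_center_direction_small {D : MvPolynomial (TernaryIndex p) ℂ} (hD : D ≠ 0)
    (s : affineHypersurfaceComplement ![D]) {y v : TernaryIndex p → ℂ} (hy : eval y D = 0)
    (htr : ∑ k, eval y (pderiv k D) * v k ≠ 0) {ε₀ : ℝ} (hε₀ : 0 < ε₀) :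
    ∃ μ : Meridian ![D] s 0, μ.y = y ∧ μ.v = v ∧ μ.ε ≤ ε₀ := by
  have hU : IsPathConnected (affineHypersurfaceComplement ![D]) :=
    MeridianConj.isPathConnected_affineHypersurfaceComplement fun j => by fin_cases j; exact hD
  obtain ⟨μ₁, hy₁, hv₁⟩ := MeridianConj.exists_meridian hU s (j := 0) (y := y) (v := v) hy
    (fun i hi => absurd (Subsingleton.elim i 0) hi) htr
  subst hy₁ hv₁
  -- shrink the radius to `ε := min μ₁.ε ε₀`
  set ε : ℝ := min μ₁.ε ε₀ with hε
  have hεpos : 0 < ε := lt_min μ₁.ε_pos hε₀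
  have hdisc : ∀ c : ℂ, c ≠ 0 → ‖c‖ ≤ ε → discPoint μ₁.y μ₁.v c ∈ affineHypersurfaceComplement ![D] :=
    fun c hc0 hc => μ₁.discPoint_mem c hc0 (hc.trans (min_le_left _ _))
  have hend : discPoint μ₁.y μ₁.v (ε : ℂ) ∈ affineHypersurfaceComplement ![D] :=
    hdisc _ (by exact_mod_cast hεpos.ne') (by simp [abs_of_pos hεpos])
  have hj : JoinedIn (affineHypersurfaceComplement ![D]) (s : TernaryIndex p → ℂ) (discPoint μ₁.y μ₁.v (ε : ℂ)) :=
    hU.joinedIn s s.2 _ hend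
  let leash : Path s ⟨discPoint μ₁.y μ₁.v (ε : ℂ), hend⟩ :=
    ⟨⟨fun t => ⟨hj.somePath t, hj.somePath_mem t⟩, by fun_prop⟩, by ext; simp, by ext; simp⟩
  let μ : Meridian ![D] s 0 :=
    { y := μ₁.y, v := μ₁.v, ε := ε, ε_pos := hεpos, eval_center := μ₁.eval_center,
      eval_center_ne := μ₁.eval_center_ne, transversal := μ₁.transversal, discPoint_mem := hdisc,
      leashEnd_mem := hend, leash := leash }
  exact ⟨μ, rfl, rfl, min_le_right _ _⟩

end Meridians

/-! ### §4 F1‡ from the circle -/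

/-- **F1‡ at `p` from the explicit small circles.** Let `p ≥ 3`, `f₁ = x₂^{p−2}x₀x₁ + x₀^p + x₁^p` (the explicit one-nodal form),
`a₁` its coefficient vector and `m₀ = x₂^p`. Suppose that for some `ε₀ > 0`, for every irreducible equation `D` of the
discriminant, coefficient chart `χ` and meridian `μ` of `V(D)` with centre `a₁`, direction `e_{m₀}` and radius `≤ ε₀`, the
transport of `R²u_*ℚ` along the boundary circle of `μ` read in `S(ℂ)` carries the local-monodromy datum. Then the datum holds
for the transport of EVERY meridian centred at a one-nodal branch curve (indeed at any centre) — the `p`-instance of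
`carlsonToledo1999_nodalMeridianLocalMonodromyBound`. [cite: CarlsonToledo1999, §6 (kdoublept) and §3 (held text p0006, p0013–p0014)]
[cite: Shimada2010ZvK, §3 Prop. 3.4] -/
theorem nodalMeridianLocalMonodromyBound_of_circle {p : ℕ} [NeZero p] (hp3 : 3 ≤ p)
    (hG : ∃ ε₀ : ℝ, 0 < ε₀ ∧ ∀ (D : MvPolynomial (TernaryIndex p) ℂ), Irreducible D → IsDiscriminantEquation p D →
      ∀ (χ : ComplexPoints (cyclicCoverBase p) ≃ₜ affineHypersurfaceComplement ![D]), IsCoefficientChart p D χ →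
      ∀ {b : affineHypersurfaceComplement ![D]} (μ : Meridian ![D] b 0),
        μ.y = coeffsOf 1 p (X 2 ^ (p - 3 + 1) * (X 0 * X 1) + X 0 ^ (p - 3 + 3) + X 1 ^ (p - 3 + 3)) →
        μ.v = Pi.single ⟨Finsupp.single (2 : Fin 3) p, degree_single_two p⟩ 1 → μ.ε ≤ ε₀ →
        ∃ T : bettiCohomology (fiberOver (cyclicCoverFamily p) (χ.symm μ.leashEnd)) 2 ≃ₗ[ℚ]
            bettiCohomology (fiberOver (cyclicCoverFamily p) (χ.symm μ.leashEnd)) 2,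
          IsRatTransport (cyclicCoverFamily p) 2 (cyclicCoverFamily_locallyTrivial p)
            (cyclicCoverLoopClass p (μ.circle.map χ.symm.continuous)) T ∧
          ∃ V : Submodule ℚ (bettiCohomology (fiberOver (cyclicCoverFamily p) (χ.symm μ.leashEnd)) 2),
            (∀ x, T x - x ∈ V) ∧ (∀ v ∈ V, (∑ i ∈ Finset.range p, (T ^ i) v) = 0) ∧ Module.finrank ℚ V ≤ p - 1)
    (D : MvPolynomial (TernaryIndex p) ℂ) (hirr : Irreducible D) (hDeq : IsDiscriminantEquation p D)
    (χ : ComplexPoints (cyclicCoverBase p) ≃ₜ affineHypersurfaceComplement ![D]) (hχ : IsCoefficientChart p D χ)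
    (b : affineHypersurfaceComplement ![D]) (s : ComplexPoints (cyclicCoverBase p)) (hbs : χ.symm b = s)
    (μ : Meridian ![D] b 0) (γ : Path s s) (hγ : ∀ θ, χ (γ θ) = μ.loop θ) :
    ∃ (T : bettiCohomology (fiberOver (cyclicCoverFamily p) s) 2 ≃ₗ[ℚ] bettiCohomology (fiberOver (cyclicCoverFamily p) s) 2)
      (V : Submodule ℚ (bettiCohomology (fiberOver (cyclicCoverFamily p) s) 2)),
      IsRatTransport (cyclicCoverFamily p) 2 (cyclicCoverFamily_locallyTrivial p) (cyclicCoverLoopClass p γ) T ∧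
      (∀ x, T x - x ∈ V) ∧
      (∀ v ∈ V, (∑ i ∈ Finset.range p, (T ^ i) v) = 0) ∧
      Module.finrank ℚ V ≤ p - 1 := by
  classical
  subst hbs
  obtain ⟨m, rfl⟩ : ∃ m, p = m + 3 := ⟨p - 3, by omega⟩
  simp only [show m + 3 - 3 = m by omega] at hG
  obtain ⟨ε₀, hε₀, hG⟩ := hG
  haveI hfin : ∀ t : ComplexPoints (cyclicCoverBase (m + 3)),
      Module.Finite ℚ (bettiCohomology (fiberOver (cyclicCoverFamily (m + 3)) t) 2) := fun t =>
    BettiUniverse.finite ((isSmoothProjectiveFamily_cyclicCoverFamily (m + 3)).isSmoothProjective t) 2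
  -- the given loop IS the meridian loop read through `χ⁻¹`
  have hγeq : γ = μ.loop.map χ.symm.continuous := by
    refine Path.ext (funext fun θ => ?_)
    have h := congrArg χ.symm (hγ θ)
    rwa [χ.symm_apply_apply] at h
  -- the explicit one-nodal form and its transversal direction
  set f₁ : MvPolynomial (Fin 3) ℂ := X 2 ^ (m + 1) * (X 0 * X 1) + X 0 ^ (m + 3) + X 1 ^ (m + 3) with hf₁
  have hf₁h : f₁.IsHomogeneous (m + 3) := isHomogeneous_nodalTernaryForm m
  have hnod : IsNodalFormWithNodes (n := 1) f₁ ![![0, 0, 1]] := isNodalFormWithNodes_nodalTernaryForm m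
  set m₀ : TernaryIndex (m + 3) := ⟨Finsupp.single (2 : Fin 3) (m + 3), degree_single_two (m + 3)⟩ with hm₀
  have hV : ∀ a : DegIndex 1 (m + 3) → ℂ, a ∈ singularCoeffs 1 (m + 3) ↔ eval a D = 0 :=
    mem_singularCoeffs_iff_of_isDiscriminantEquation (by omega) hDeq
  have hy : eval (coeffsOf 1 (m + 3) f₁) D = 0 :=
    (hV _).1 (coeffsOf_mem_singularCoeffs_of_uninodal (by omega) hf₁h hnod)
  have htr : ∑ k, eval (coeffsOf 1 (m + 3) f₁) (pderiv k D) * (Pi.single m₀ (1 : ℂ) : TernaryIndex (m + 3) → ℂ) k ≠ 0 := by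
    rw [Finset.sum_eq_single m₀ (fun b _ hb => by simp [hb])
      (fun h => absurd (Finset.mem_univ m₀) h)]
    simp only [Pi.single_eq_same, mul_one]
    refine eval_pderiv_ne_zero_of_uninodal_of_prod_ne_zero hirr hV hf₁h hnod m₀ ?_
    rw [hm₀, Finsupp.prod_single_index (by simp)]
    simp
  -- the explicit small meridian at the same base point `b`, its circle and leash transports
  obtain ⟨μ₀, hμ₀y, hμ₀v, hμ₀ε⟩ :=
    exists_meridian_center_direction_small (p := m + 3) hirr.ne_zero b hy htr hε₀
  obtain ⟨Tc, hTc, hdat⟩ := hG D hirr hDeq χ hχ μ₀ hμ₀y hμ₀v hμ₀ε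
  obtain ⟨TL, hloop₀⟩ := exists_isRatTransport_meridian_loop χ μ₀ hTc
  have hdat₀ := exists_localMonodromyDatum_of_conj (p := m + 3) (m := m + 3 - 1) Tc TL hdat
  -- a transport along the loop of `μ`
  obtain ⟨T, hT⟩ := exists_ratTransport (cyclicCoverFamily (m + 3)) 2 (cyclicCoverFamily_locallyTrivial (m + 3))
    (isRationalClass_transportFun_cyclicCoverFamily) (cyclicCoverLoopClass (m + 3) (μ.loop.map χ.symm.continuous))
  -- the two loops are conjugate in `π₁(S(ℂ))`: push the meridian conjugacy through `χ⁻¹`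
  have hirr' : ∀ j : Fin 1, Irreducible ((![D] : Fin 1 → MvPolynomial (TernaryIndex (m + 3)) ℂ) j) := fun j => by
    fin_cases j; exact hirr
  have hconjμ : IsConj μ₀.loopClass μ.loopClass :=
    affineHypersurfaceComplement_meridian_isConj_holds (TernaryIndex (m + 3)) 1 ![D] hirr' b 0 μ₀ μ
  let Ψ : (Set.univ : Set (ComplexPoints (cyclicCoverBase (m + 3)))) ≃ₜ affineHypersurfaceComplement ![D] :=
    (Homeomorph.Set.univ _).trans χ
  have hΨ : Ψ.symm b = ⟨χ.symm b, Set.mem_univ _⟩ := rfl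
  let φ := FundamentalGroup.mapOfEq (Ψ.symm : C(affineHypersurfaceComplement ![D],
    (Set.univ : Set (ComplexPoints (cyclicCoverBase (m + 3)))))) hΨ
  have hφ : ∀ ν : Meridian ![D] b 0, φ ν.loopClass =
      FundamentalGroup.fromPath (cyclicCoverLoopClass (m + 3) (ν.loop.map χ.symm.continuous)) := by
    intro ν
    dsimp only [φ]
    erw [Meridian.loopClass_def, mapOfEq_fromPath_mk]
    change FundamentalGroup.fromPath (Path.Homotopic.Quotient.mk _) = FundamentalGroup.fromPath (Path.Homotopic.Quotient.mk _)
    congr 2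
  have hconj : IsConj (FundamentalGroup.fromPath (cyclicCoverLoopClass (m + 3) (μ₀.loop.map χ.symm.continuous)))
      (FundamentalGroup.fromPath (cyclicCoverLoopClass (m + 3) (μ.loop.map χ.symm.continuous))) := by
    rw [← hφ μ₀, ← hφ μ]
    exact MonoidHom.map_isConj φ hconjμ
  obtain ⟨g, -, hg⟩ := exists_conj_of_isConj (cyclicCoverFamily (m + 3)) 2 (cyclicCoverFamily_locallyTrivial (m + 3))
    (isRationalClass_transportFun_cyclicCoverFamily) _ hconj hloop₀ hT
  obtain ⟨V, hV₁, hV₂, hV₃⟩ := exists_localMonodromyDatum_of_mul_conj (p := m + 3) (m := m + 3 - 1) _ g hdat₀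
  refine ⟨T, V, ?_, ?_, ?_, hV₃⟩
  · rw [hγeq]; exact hT
  · intro x; rw [hg]; exact hV₁ x
  · intro v hv; rw [hg]; exact hV₂ v hv

/-- **The `p`-instance of F1‡ from the explicit small circles**, in the exact quantifier shape of
`carlsonToledo1999_nodalMeridianLocalMonodromyBound` (the hypothesis that the centre of `μ` is one-nodal is not even needed:
all meridians of the irreducible discriminant are conjugate). [cite: CarlsonToledo1999, §6 (kdoublept) (held text p0013–p0014)]
[cite: Shimada2010ZvK, §3 Prop. 3.4] -/
theorem nodalMeridianLocalMonodromyBound_at_of_circle {p : ℕ} [NeZero p] (hp3 : 3 ≤ p)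
    (hG : ∃ ε₀ : ℝ, 0 < ε₀ ∧ ∀ (D : MvPolynomial (TernaryIndex p) ℂ), Irreducible D → IsDiscriminantEquation p D →
      ∀ (χ : ComplexPoints (cyclicCoverBase p) ≃ₜ affineHypersurfaceComplement ![D]), IsCoefficientChart p D χ →
      ∀ {b : affineHypersurfaceComplement ![D]} (μ : Meridian ![D] b 0),
        μ.y = coeffsOf 1 p (X 2 ^ (p - 3 + 1) * (X 0 * X 1) + X 0 ^ (p - 3 + 3) + X 1 ^ (p - 3 + 3)) →
        μ.v = Pi.single ⟨Finsupp.single (2 : Fin 3) p, degree_single_two p⟩ 1 → μ.ε ≤ ε₀ →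
        ∃ T : bettiCohomology (fiberOver (cyclicCoverFamily p) (χ.symm μ.leashEnd)) 2 ≃ₗ[ℚ]
            bettiCohomology (fiberOver (cyclicCoverFamily p) (χ.symm μ.leashEnd)) 2,
          IsRatTransport (cyclicCoverFamily p) 2 (cyclicCoverFamily_locallyTrivial p)
            (cyclicCoverLoopClass p (μ.circle.map χ.symm.continuous)) T ∧
          ∃ V : Submodule ℚ (bettiCohomology (fiberOver (cyclicCoverFamily p) (χ.symm μ.leashEnd)) 2),
            (∀ x, T x - x ∈ V) ∧ (∀ v ∈ V, (∑ i ∈ Finset.range p, (T ^ i) v) = 0) ∧ Module.finrank ℚ V ≤ p - 1)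
    (f : MvPolynomial (Fin 3) ℂ) (D : MvPolynomial (TernaryIndex p) ℂ) (hirr : Irreducible D) (hDeq : IsDiscriminantEquation p D)
    (χ : ComplexPoints (cyclicCoverBase p) ≃ₜ affineHypersurfaceComplement ![D]) (hχ : IsCoefficientChart p D χ)
    (μ : Meridian ![D] (χ (cyclicCoverPoint p f)) 0)
    (γ : Path (cyclicCoverPoint p f) (cyclicCoverPoint p f)) (hγ : ∀ θ, χ (γ θ) = μ.loop θ) :
    ∃ (T : bettiCohomology (fiberOver (cyclicCoverFamily p) (cyclicCoverPoint p f)) 2 ≃ₗ[ℚ]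
          bettiCohomology (fiberOver (cyclicCoverFamily p) (cyclicCoverPoint p f)) 2)
      (V : Submodule ℚ (bettiCohomology (fiberOver (cyclicCoverFamily p) (cyclicCoverPoint p f)) 2)),
      IsRatTransport (cyclicCoverFamily p) 2 (cyclicCoverFamily_locallyTrivial p) (cyclicCoverLoopClass p γ) T ∧
      (∀ x, T x - x ∈ V) ∧
      (∀ v ∈ V, (∑ i ∈ Finset.range p, (T ^ i) v) = 0) ∧
      Module.finrank ℚ V ≤ p - 1 :=
  nodalMeridianLocalMonodromyBound_of_circle hp3 hG D hirr hDeq χ hχ _ _ (χ.symm_apply_apply _) μ γ hγ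

end Summit.HodgeConjecture.HodgeConjecture.Theorems.CyclicUnitaryPowersNodalMeridianOfCircle

end
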